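import Mathlib
import Summits.NavierStokesRegularity.NavierStokesRegularity.Theorems.LerayQuarterDissipationFiniteDissipationLiouvilleCrossFlowThreshold
import Literature.Analysis.FluidPDE.NSLocalLerayBackwardUniqueness
import Literature.Analysis.FluidPDE.BarkerPrange2020VorticityAlignmentTypeIHolds
import HarnessLib

/-!
# Crux `FiniteDissipationLiouville` (stmt-NavierStokesRegularity-22144): THE PRODUCT THRESHOLD ONE,
# file A — pointwise algebra of the slack and the equality-case rigidity BY ANALYTICITY

Theorems file of route `LerayQuarterDissipation` (lead prover g18; `--supports` the crux).
Navier–Stokes regularity is NOT proved by anything here; no summit is.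

The tree's law-free PRODUCT row T49′ (`…SimilarityEnstrophy.typeI_ancient_eq_zero_of_lambProduct_lt_one_sim`,
pub-ns-dss): an enveloped KNSS-gauge Type-I field whose Leray orbit obeys
`⟪U, Ω × curl Ω⟫ ≤ θ‖Ω‖‖curl Ω‖` pointwise with `θ < 1` vanishes (physically
`√(−t)⟪u, ω × curl ω⟫ ≤ θ‖ω‖‖curl ω‖`). It contains the Λ-directional row T49
(`⟪U, Λ⟫ ≤ θ‖Λ‖`, `Λ = Ω × curl Ω`), the cross-flow row (`‖Ω × U‖ ≤ θ‖Ω‖`) and the time-constant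
row (`‖U‖ ≤ θ`, i.e. Type-I constant `θ`). Lead g17 settled the ENDPOINT `θ = 1` of the cross-flow
row by an antitone-enstrophy + zoom-out argument with a «half-Beltrami» rigidity. This file supplies
the pointwise input for the endpoint `θ = 1` of the whole PRODUCT row, with a much shorter rigidity:

* `lambProductSlack_nonneg` / `eq_of_lambProductSlack_eq_zero` — under `⟪U, Ω × C⟫ ≤ ‖Ω‖‖C‖` the
  slack density `σ = ‖C‖² + ¼‖Ω‖² − ⟪U, Ω × C⟫ = (‖C‖ − ½‖Ω‖)² + (‖Ω‖‖C‖ − ⟪U, Ω × C⟫)` is `≥ 0`,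
  and `σ = 0` forces `‖C‖ = ½‖Ω‖` and `⟪U, Ω × C⟫ = ‖Ω‖‖C‖`;
* `eq_zero_of_lambProduct_eq_of_norm_lt_one` — **a slow velocity cannot saturate the product
  bound**: `⟪U, Ω × C⟫ = ‖Ω‖‖C‖`, `‖C‖ = ½‖Ω‖` and `‖U‖ < 1` force `Ω = 0`;
* `lambProduct_of_crossFlow_le`, `lambProduct_of_lambDirection_le`, `lambProduct_of_norm_le_one` —
  the product hypothesis at `θ = 1` is implied by cross-flow `≤ 1`, by the Λ-directional bound `≤ 1`,
  and by `‖U‖ ≤ 1` (Type-I constant `≤ 1`);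
* `analyticOnNhd_lerayOrbit` / `lerayVorticity_eq_zero_of_eqOn_far` — the Leray orbit slices of a
  KNSS-gauge Type-I field are REAL-ANALYTIC (`IsTypeIAncientMild.analyticOnNhd_slice_univ`,
  Lemarié-Rieusset 2016 Thm 9.12, in tree), so a similarity vorticity vanishing outside a ball
  vanishes identically (identity theorem, `curl_eq_zero_of_eqOn_open`);
* **`lerayVorticity_slice_eq_zero_of_lambProductSlack_eq_zero`** — on a similarity slice of a
  KNSS-gauge Type-I field with a Type-I envelope `‖U(y)‖ ≤ A/(‖y‖+1)`, the product hypothesis at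
  `θ = 1` and vanishing slack density force `Ω ≡ 0` on that slice: the envelope gives `‖U‖ < 1`
  outside the ball of radius `max A 0`, the equality case kills `Ω` there, analyticity everywhere.

HONEST FRAMING. Pointwise / slice-level lemmas about a HYPOTHETICAL object; they remove nothing from
the catalogued DSS wall by themselves (the endpoint theorem is in the sequel `…LambProductThreshold`).
Nothing here bears on Navier–Stokes regularity or blow-up.

References: Lemarié-Rieusset, *The Navier–Stokes Problem in the 21st Century* (2016) Thm 9.12
(analyticity of bounded mild solutions); Doering–Gibbon (1995) §1.4 (Lamb form of the enstrophy
production); folklore vector algebra.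
-/

noncomputable section

set_option linter.dupNamespace false

namespace Summit.NavierStokesRegularity.NavierStokesRegularity.Theorems.FiniteDissipationLiouville.LambProduct

open MeasureTheory Set Filter Topology Metric InnerProductSpace Function Real
open scoped RealInnerProductSpace ContDiff
open Literature.Analysis Literature.Analysis.FluidPDE
open Summit.NavierStokesRegularity.NavierStokesRegularity.Theorems
open Summit.NavierStokesRegularity.NavierStokesRegularity.Theorems.SimilarityEnstrophy
open Summit.NavierStokesRegularity.NavierStokesRegularity.Theorems.FiniteDissipationLiouville.CrossFlow

/-! ### Pointwise algebra of the slack density under the product hypothesis -/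

section Algebra

/-- **The slack density under the product hypothesis is nonnegative**: if `⟪U, Ω × C⟫ ≤ ‖Ω‖‖C‖`
then `0 ≤ ‖C‖² + ¼‖Ω‖² − ⟪U, Ω × C⟫` (`= (‖C‖ − ½‖Ω‖)² + (‖Ω‖‖C‖ − ⟪U, Ω × C⟫)`). [folklore] -/
theorem lambProductSlack_nonneg {U Ω C : EuclideanSpace ℝ (Fin 3)} (h : ⟪U, cross Ω C⟫ ≤ ‖Ω‖ * ‖C‖) :
    0 ≤ ‖C‖ ^ 2 + (1 / 4) * ‖Ω‖ ^ 2 - ⟪U, cross Ω C⟫ := by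
  nlinarith [sq_nonneg (‖C‖ - ‖Ω‖ / 2)]

/-- **Equality case of the product bound.** If `⟪U, Ω × C⟫ ≤ ‖Ω‖‖C‖` and the slack density
vanishes, then `‖C‖ = ½‖Ω‖` and `⟪U, Ω × C⟫ = ‖Ω‖‖C‖`. [folklore] -/
theorem eq_of_lambProductSlack_eq_zero {U Ω C : EuclideanSpace ℝ (Fin 3)}
    (h : ⟪U, cross Ω C⟫ ≤ ‖Ω‖ * ‖C‖)
    (hσ : ‖C‖ ^ 2 + (1 / 4) * ‖Ω‖ ^ 2 - ⟪U, cross Ω C⟫ = 0) :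
    ‖C‖ = (1 / 2) * ‖Ω‖ ∧ ⟪U, cross Ω C⟫ = ‖Ω‖ * ‖C‖ := by
  have hsq : (‖C‖ - ‖Ω‖ / 2) ^ 2 = 0 := by
    nlinarith [sq_nonneg (‖C‖ - ‖Ω‖ / 2)]
  have h1 : ‖C‖ - ‖Ω‖ / 2 = 0 := pow_eq_zero_iff (n := 2) (by norm_num) |>.1 hsq
  refine ⟨by linarith, ?_⟩
  have : ‖C‖ = ‖Ω‖ / 2 := by linarith
  rw [this] at hσ ⊢
  nlinarith

/-- **A slow velocity cannot saturate the product bound**: `⟪U, Ω × C⟫ = ‖Ω‖‖C‖` with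
`‖C‖ = ½‖Ω‖` and `‖U‖ < 1` force `Ω = 0` (`⟪U, Ω × C⟫ ≤ ‖U‖‖Ω‖‖C‖`). [folklore] -/
theorem eq_zero_of_lambProduct_eq_of_norm_lt_one {U Ω C : EuclideanSpace ℝ (Fin 3)}
    (heq : ⟪U, cross Ω C⟫ = ‖Ω‖ * ‖C‖) (hC : ‖C‖ = (1 / 2) * ‖Ω‖) (hU : ‖U‖ < 1) : Ω = 0 := by
  by_contra hne
  have hpos : 0 < ‖Ω‖ := norm_pos_iff.2 hne
  have hle : ⟪U, cross Ω C⟫ ≤ ‖U‖ * (‖Ω‖ * ‖C‖) :=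
    (real_inner_le_norm _ _).trans (mul_le_mul_of_nonneg_left (norm_cross_le_norm_mul_norm _ _)
      (norm_nonneg _))
  rw [heq, hC] at hle
  have hq : 0 < ‖Ω‖ * ((1 / 2) * ‖Ω‖) := by positivity
  have : 0 < (1 - ‖U‖) * (‖Ω‖ * ((1 / 2) * ‖Ω‖)) := mul_pos (by linarith) hq
  nlinarith

/-- **Cross-flow `≤ 1` implies the product hypothesis at `θ = 1`** (scalar triple product:
`⟪U, Ω × C⟫ = −⟪Ω × U, C⟫ ≤ ‖Ω × U‖‖C‖`). [folklore] -/
theorem lambProduct_of_crossFlow_le {U Ω : EuclideanSpace ℝ (Fin 3)} (h : ‖cross Ω U‖ ≤ ‖Ω‖)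
    (C : EuclideanSpace ℝ (Fin 3)) : ⟪U, cross Ω C⟫ ≤ ‖Ω‖ * ‖C‖ := by
  have := inner_lamb_le_of_crossFlow (θ := 1) U Ω C (by rwa [one_mul])
  rwa [one_mul] at this

/-- **The Λ-directional bound `≤ 1` implies the product hypothesis at `θ = 1`**
(`‖Ω × C‖ ≤ ‖Ω‖‖C‖`). [folklore] -/
theorem lambProduct_of_lambDirection_le {U Ω C : EuclideanSpace ℝ (Fin 3)}
    (h : ⟪U, cross Ω C⟫ ≤ ‖cross Ω C‖) : ⟪U, cross Ω C⟫ ≤ ‖Ω‖ * ‖C‖ :=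
  h.trans (norm_cross_le_norm_mul_norm _ _)

/-- **Speed `≤ 1` implies the product hypothesis at `θ = 1`** (`⟪U, X⟫ ≤ ‖U‖‖X‖ ≤ ‖X‖`): the
time-constant row at its endpoint (Type-I constant `≤ 1` in the gauge of the envelope) is a sub-case.
[folklore] -/
theorem lambProduct_of_norm_le_one {U : EuclideanSpace ℝ (Fin 3)} (hU : ‖U‖ ≤ 1)
    (Ω C : EuclideanSpace ℝ (Fin 3)) : ⟪U, cross Ω C⟫ ≤ ‖Ω‖ * ‖C‖ := by
  have h1 : ⟪U, cross Ω C⟫ ≤ ‖U‖ * ‖cross Ω C‖ := real_inner_le_norm _ _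
  have h2 : ‖U‖ * ‖cross Ω C‖ ≤ 1 * ‖cross Ω C‖ := mul_le_mul_of_nonneg_right hU (norm_nonneg _)
  rw [one_mul] at h2
  exact (h1.trans h2).trans (norm_cross_le_norm_mul_norm _ _)

end Algebra

/-! ### Analyticity of the Leray orbit slices; a vorticity vanishing far out vanishes -/

section Analytic

variable {C : ℝ} {V : ℝ → EuclideanSpace ℝ (Fin 3) → EuclideanSpace ℝ (Fin 3)}

/-- **The Leray orbit slices of a KNSS-gauge Type-I field are real-analytic on `ℝ³`**
(`U(s) = e^{−s/2} V(−e^{−s}, e^{−s/2}·)`: a real-analytic slice composed with a linear map and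
scaled). [cite: LemarieRieusset2016, Thm. 9.12 (PDF p. 260)] -/
theorem analyticOnNhd_lerayOrbit (hV : IsTypeIAncientMild C V) (s : ℝ) :
    AnalyticOnNhd ℝ (lerayOrbit V s) univ := by
  have ht : -Real.exp (-s) < 0 := neg_neg_of_pos (Real.exp_pos _)
  have hsl := hV.analyticOnNhd_slice_univ ht
  have hcomp : AnalyticOnNhd ℝ (V (-Real.exp (-s)) ∘
      ⇑(Real.exp (-s / 2) • ContinuousLinearMap.id ℝ (EuclideanSpace ℝ (Fin 3)))) univ := by
    have := hsl.compContinuousLinearMap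
      (u := Real.exp (-s / 2) • ContinuousLinearMap.id ℝ (EuclideanSpace ℝ (Fin 3)))
    rwa [preimage_univ] at this
  have e : lerayOrbit V s = Real.exp (-s / 2) • (V (-Real.exp (-s)) ∘
      ⇑(Real.exp (-s / 2) • ContinuousLinearMap.id ℝ (EuclideanSpace ℝ (Fin 3)))) := by
    funext y
    simp [lerayOrbit_apply]
  rw [e]
  exact hcomp.const_smul

/-- **A similarity vorticity vanishing outside a ball vanishes identically** (identity theorem for
the real-analytic slice; `ℝ³` minus a closed ball is a non-empty open set). [folklore] -/
theorem lerayVorticity_eq_zero_of_eqOn_far (hV : IsTypeIAncientMild C V) (s : ℝ) {R : ℝ}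
    (h : ∀ y : EuclideanSpace ℝ (Fin 3), R < ‖y‖ → lerayVorticity V s y = 0) :
    ∀ y, lerayVorticity V s y = 0 := by
  have han := analyticOnNhd_lerayOrbit hV s
  -- the open set `{‖y‖ > R}` is non-empty
  have hopen : IsOpen {y : EuclideanSpace ℝ (Fin 3) | R < ‖y‖} :=
    isOpen_lt continuous_const continuous_norm
  have hne : ({y : EuclideanSpace ℝ (Fin 3) | R < ‖y‖}).Nonempty :=
    NormedSpace.exists_lt_norm ℝ (EuclideanSpace ℝ (Fin 3)) R
  intro y
  have := curl_eq_zero_of_eqOn_open han hopen hne (fun x hx => by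
    have hx' : R < ‖x‖ := hx
    have := h x hx'
    rwa [lerayVorticity_apply] at this) y
  rwa [lerayVorticity_apply]

end Analytic

/-! ### On a similarity slice of an enveloped Type-I field -/

section Slice

variable {C A : ℝ} {V : ℝ → EuclideanSpace ℝ (Fin 3) → EuclideanSpace ℝ (Fin 3)}

/-- **Equality case of the product threshold on an ENVELOPED slice forces zero vorticity.** Let `V`
be a KNSS-gauge Type-I field (`IsTypeIAncientMild C V`) with a Type-I envelope `HasTypeIDecay A V`,
and let `s` be a similarity time at which the product hypothesis at the threshold,
`⟪U, Ω × curl Ω⟫ ≤ ‖Ω‖‖curl Ω‖`, and the vanishing of the slack density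
`‖curl Ω‖² + ¼‖Ω‖² − ⟪U, Ω × curl Ω⟫ = 0` hold at every point (`U = lerayOrbit V s`,
`Ω = lerayVorticity V s`). Then `Ω(s) ≡ 0`: outside the ball of radius `max A 0` the envelope gives
`‖U(y)‖ ≤ A/(‖y‖+1) < 1`, so the equality case kills `Ω` there
(`eq_zero_of_lambProduct_eq_of_norm_lt_one`), and the real-analytic vorticity slice then vanishes
everywhere (`lerayVorticity_eq_zero_of_eqOn_far`). [folklore] -/
theorem lerayVorticity_slice_eq_zero_of_lambProductSlack_eq_zero (hV : IsTypeIAncientMild C V)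
    (hdec : HasTypeIDecay A V) (s : ℝ)
    (hP : ∀ y, ⟪lerayOrbit V s y, cross (lerayVorticity V s y) (curl (lerayVorticity V s) y)⟫ ≤
      ‖lerayVorticity V s y‖ * ‖curl (lerayVorticity V s) y‖)
    (hσ : ∀ y, ‖curl (lerayVorticity V s) y‖ ^ 2 + (1 / 4) * ‖lerayVorticity V s y‖ ^ 2 -
      ⟪lerayOrbit V s y, cross (lerayVorticity V s y) (curl (lerayVorticity V s) y)⟫ = 0) :
    ∀ y, lerayVorticity V s y = 0 := by
  refine lerayVorticity_eq_zero_of_eqOn_far hV s (R := max A 0) fun y hy => ?_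
  obtain ⟨hC, heq⟩ := eq_of_lambProductSlack_eq_zero (hP y) (hσ y)
  refine eq_zero_of_lambProduct_eq_of_norm_lt_one heq hC ?_
  have hUle := hdec.norm_lerayOrbit_le s y
  have hden : 0 < ‖y‖ + 1 := by positivity
  have hA : A < ‖y‖ + 1 := by linarith [le_max_left A 0, le_max_right A 0]
  exact hUle.trans_lt ((div_lt_one hden).2 hA)

/-- The same with the hypotheses quantified over all similarity times, at a time `s` where the
slack density vanishes. [folklore] -/
theorem lerayVorticity_slice_eq_zero_of_lambProductSlack_eq_zero' (hV : IsTypeIAncientMild C V)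
    (hdec : HasTypeIDecay A V)
    (hP : ∀ (s : ℝ) (y : EuclideanSpace ℝ (Fin 3)),
      ⟪lerayOrbit V s y, cross (lerayVorticity V s y) (curl (lerayVorticity V s) y)⟫ ≤
        ‖lerayVorticity V s y‖ * ‖curl (lerayVorticity V s) y‖) (s : ℝ)
    (hσ : ∀ y, ‖curl (lerayVorticity V s) y‖ ^ 2 + (1 / 4) * ‖lerayVorticity V s y‖ ^ 2 -
      ⟪lerayOrbit V s y, cross (lerayVorticity V s y) (curl (lerayVorticity V s) y)⟫ = 0) :
    ∀ y, lerayVorticity V s y = 0 :=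
  lerayVorticity_slice_eq_zero_of_lambProductSlack_eq_zero hV hdec s (hP s) hσ

end Slice

end Summit.NavierStokesRegularity.NavierStokesRegularity.Theorems.FiniteDissipationLiouville.LambProduct

end
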